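import Summits.QuantumFields.YangMills.Theorems.UnitScaleTiltFluctuationComparisonRegPrGlobalSlackLegOldTermsKernelFormAnalytic
import Summits.QuantumFields.YangMills.Theorems.UnitScaleTiltFluctuationComparisonRegPrGlobalSlackCanonicalPolymersCoreSizesV4
import HarnessLib

/-!
# `UnitScaleTiltFluctuationComparisonRegPrGlobalSlackLegKernelBudgetPointwise` — THE (43) KERNEL BUDGET OF THE NATURAL CHART FAMILY FROM PRINT'S POINTWISE (43) DECAY
# (crux `FluctuationComparisonRegPrIntL`, stmt-QuantumFields-20520, skeleton v5kD, STUB 3⁗χ(v4) `stub_globalTwoRunSlackFamChiV4`; width seat ym-ust-20520-w2 g5 (LEAD-side helper for the (B3) door);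
# count-neutral, def-free, registry untouched)

WHY.  In the natural-object doors of 3⁗χ(v4) (ym-inputs-p11's ✓`chartAnalyticOwnΦ_rescaleW_naturalChart_rows(_of_local)`, this seat's `…NaturalRowsTwoRunDoor(Local)`) the analyticity
row (A) of the leg-rescaled natural chart family `Φ♮[birthChartRows q, N]` is traded for (ℓ) locality and (k) THE (43) KERNEL BUDGET at every listed block `blockSet K (1+b) y`:
`Σ_{n∈[2,7)} (n!)⁻¹ Σ_{c : Fin n → PBond} ‖N K b y n c‖ · Πᵢ e^{κ′ d(cᵢ)} · (ρ/2)ⁿ ≤ C_A · e^{−κ 𝓛_K(1+b, blockSet y)}` — a SUMMED statement.  Print's (43) is POINTWISE: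
«|𝒫_j(Y_j)(c₁,…,c_n)| ≤ O(1) Πᵢ exp(−κ₁ (M₁Lʲη)⁻¹|c_{i,−} − y|)» with a rate `κ₁` LARGER than the leg weight `κ′`.  THIS FILE derives the budget from the pointwise form by the tree's
leg geometry: the legs at canonical distance `∼ r` from a block number `O(r²)` (✓`legSummableT_canonRows`: `Σ_c e^{−δ d(c)} ≤ legSumConst·(1 + 𝓛)`), a block's canonical tree length is
`≤ L³` (✓`canonTreeLenRows_blockSet_le`), and `Σ_c Πᵢ f(cᵢ) = (Σ_c f c)ⁿ` (`Fintype.sum_pow`):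

* ★ **`kernelBudget_blockSet_of_pointwise`**: `‖N K b y n c‖ ≤ A · Πᵢ e^{−κ₁ d(cᵢ)}` at every listed block (`κ′ < κ₁`, `0 ≤ A`, `0 ≤ ρ`, decay `κ ≥ 0`) ⟹ the budget with
  `C_A := A · e^{κL³} · Σ_{n∈[2,7)} (n!)⁻¹ (legSumConst(κ₁−κ′) · (1 + L³) · ρ/2)ⁿ` — the shape consumed by `hker` of ✓p630833 / ✓p633974 (any radius `ρ`, e.g. `𝔠.ρ·e^{−κ′R}`).

HONEST SCOPE.  Lattice bookkeeping; the pointwise decay is a HYPOTHESIS (print's (43), the definer's reading of the record's kernels), not asserted; nothing of [Balaban1985UV3] is asserted;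
no stub / crux / registry object touched (`--supports stmt-QuantumFields-20520`); no summit / rung / gap claim (YM₃ on T³ is ladder rung R3, not the Clay problem).  L-floor: none.

References: T. Bałaban, CMP 102 (1985) 255–275 [Balaban1985UV3] ((24)–(25) p.262, (43) p.266, (45) p.267).
-/

set_option autoImplicit false

noncomputable section

open scoped BigOperators Nat
open Finset
open Literature.MathematicalPhysics.QuantumFieldTheory.Balaban1983to89
open Literature.MathematicalPhysics.QuantumFieldTheory.Balaban1983to89.T3ContinuumYM3Torus
open Literature.MathematicalPhysics.QuantumFieldTheory.Balaban1983to89.T3AlphaInputsAC (AlphaDataT3)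
open Literature.MathematicalPhysics.QuantumFieldTheory.Balaban1985CMP102
open Literature.MathematicalPhysics.QuantumFieldTheory.Balaban1985CMP102.Setting
open Summit.QuantumFields.Balaban3D.Carriers
open Summit.QuantumFields.Balaban3D.Proofs.Primitives
open Summit.QuantumFields.Balaban3D.Proofs.GroupModelLieC (lieC)
open Summit.QuantumFields.YangMills.Theorems
open Summit.QuantumFields.YangMills.Theorems.GlobalSlackKernelMatching
open Summit.QuantumFields.YangMills.Theorems.GlobalSlackCanonicalPolymers

namespace Summit.QuantumFields.YangMills.Theorems.GlobalSlackKernelLeg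

section Budget

variable {F : T3Family} {𝔠 : AlphaConsts F.L (suGroupModel 2).N} {γ : ℝ} {hγ : 0 < γ} {hγ1 : γ ≤ (min 𝔠.gamma0 1) ^ 2}
  (q : ∀ K, AlphaInputsT3AC.PkgCoreRows F 𝔠 γ hγ hγ1 K)
  (N : (K b : ℕ) → Site (F.P K) (1 + b) → (n : ℕ) → (Fin n → PBond (F.P K) b) → ContinuousMultilinearMap ℂ (fun _ : Fin n => ↥(lieC (suGroupModel 2))) ℂ)

/-- A product of leg factors splits: `Πᵢ e^{−κ₁ dᵢ} · Πᵢ e^{κ′ dᵢ} = Πᵢ e^{−(κ₁−κ′) dᵢ}`. [folklore] -/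
theorem prod_exp_neg_mul_prod_exp {n : ℕ} (κ₁ κ' : ℝ) (d : Fin n → ℝ) :
    (∏ i, Real.exp (-(κ₁ * d i))) * ∏ i, Real.exp (κ' * d i) = ∏ i, Real.exp (-((κ₁ - κ') * d i)) := by
  rw [← Finset.prod_mul_distrib]
  refine Finset.prod_congr rfl fun i _ => ?_
  rw [← Real.exp_add]
  congr 1; ring

/-- ★ **THE (43) KERNEL BUDGET AT A LISTED BLOCK FROM PRINT'S POINTWISE (43) DECAY.**  If the leg-indexed kernels of the natural chart family obey, at every listed block
`blockSet K (1+b) y ∈ canonLocRows q K k triv (1+b)` and every order `n ∈ [2,7)`, the pointwise decay `‖N K b y n c‖ ≤ A · Πᵢ e^{−κ₁·d(cᵢ)}` in the canonical leg distance with a rate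
`κ₁ > κ′`, then the leg-weighted kernel budget at radius `ρ ≥ 0` holds with decay `κ ≥ 0` in the block's tree length and the constant
`A · e^{κL³} · Σ_{n∈[2,7)} (n!)⁻¹ (legSumConst(κ₁−κ′)·(1+L³)·ρ/2)ⁿ` (`legSummableT_canonRows`, `canonTreeLenRows_blockSet_le`, `Fintype.sum_pow`).
[cite: Balaban1985UV3, (43) p.266, (45) p.267, (24)-(25) p.262] -/
theorem kernelBudget_blockSet_of_pointwise {κ' κ₁ κ A ρ : ℝ} (hκ' : κ' < κ₁) (hκ : 0 ≤ κ) (hA : 0 ≤ A) (hρ : 0 ≤ ρ)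
    (hpt : ∀ (K k b : ℕ) (y : Site (F.P K) (1 + b)), blockSet K (1 + b) y ∈ canonLocRows q K k (Hist.triv (F.P K) k) (1 + b) →
      ∀ n ∈ Finset.Ico 2 7, ∀ c : Fin n → PBond (F.P K) b,
        ‖N K b y n c‖ ≤ A * ∏ i, Real.exp (-(κ₁ * canonLegDist F K b (blockSet K (1 + b) y) (c i))))
    (K k b : ℕ) (y : Site (F.P K) (1 + b)) (hY : blockSet K (1 + b) y ∈ canonLocRows q K k (Hist.triv (F.P K) k) (1 + b)) :
    ∑ n ∈ Finset.Ico 2 7, ((n ! : ℝ))⁻¹ * ∑ c : Fin n → PBond (F.P K) b,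
        ‖N K b y n c‖ * (∏ i, Real.exp (κ' * canonLegDist F K b (blockSet K (1 + b) y) (c i))) * (ρ / 2) ^ n ≤
      (A * Real.exp (κ * (F.L : ℝ) ^ 3) *
          ∑ n ∈ Finset.Ico 2 7, ((n ! : ℝ))⁻¹ * (legSumConst F.L 𝔠 (κ₁ - κ') * (1 + (F.L : ℝ) ^ 3) * (ρ / 2)) ^ n) *
        Real.exp (-κ * (AlphaInputsT3AC.dataOfCoreRows q (canonPolymerRows q)).treeLen K (1 + b) (blockSet K (1 + b) y)) := by
  set Y : Set (Site (F.P K) 0) := blockSet K (1 + b) y with hYdef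
  set d : PBond (F.P K) b → ℝ := fun c => canonLegDist F K b Y c with hd
  set S : ℝ := legSumConst F.L 𝔠 (κ₁ - κ') * (1 + (F.L : ℝ) ^ 3) with hS
  -- the tree length of the block: `0 ≤ 𝓛 ≤ L³`
  have hbm : 1 + b ≤ F.m + K := one_add_le_of_mem_canonLocRows q hY
  have h𝓛 : (AlphaInputsT3AC.dataOfCoreRows q (canonPolymerRows q)).treeLen K (1 + b) Y ≤ (F.L : ℝ) ^ 3 := by
    change canonTreeLenRows q K (1 + b) Y ≤ _
    exact canonTreeLenRows_blockSet_le q K (1 + b) (by omega) hbm y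
  have h𝓛0 : 0 ≤ (AlphaInputsT3AC.dataOfCoreRows q (canonPolymerRows q)).treeLen K (1 + b) Y := canonTreeLenRows_nonneg q K (1 + b) Y
  -- the leg sum at the block: `Σ_c e^{−(κ₁−κ′) d(c)} ≤ S`
  have hδ : 0 < κ₁ - κ' := sub_pos.mpr hκ'
  have hSC : 0 ≤ legSumConst F.L 𝔠 (κ₁ - κ') := legSumConst_nonneg F.L 𝔠 (κ₁ - κ')
  have hleg : ∑ c : PBond (F.P K) b, Real.exp (-((κ₁ - κ') * d c)) ≤ S := by
    refine (legSummableT_canonRows q hδ K k b Y hY).trans ?_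
    rw [hS]
    exact mul_le_mul_of_nonneg_left (by linarith) hSC
  have hS0 : 0 ≤ S := by rw [hS]; positivity
  have hleg0 : 0 ≤ ∑ c : PBond (F.P K) b, Real.exp (-((κ₁ - κ') * d c)) := Finset.sum_nonneg fun c _ => (Real.exp_pos _).le
  -- order by order
  have hn : ∀ n ∈ Finset.Ico 2 7, ((n ! : ℝ))⁻¹ * ∑ c : Fin n → PBond (F.P K) b,
      ‖N K b y n c‖ * (∏ i, Real.exp (κ' * d (c i))) * (ρ / 2) ^ n ≤ A * (((n ! : ℝ))⁻¹ * (S * (ρ / 2)) ^ n) := by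
    intro n hn
    have hfac : 0 ≤ ((n ! : ℝ))⁻¹ := by positivity
    have hρn : 0 ≤ (ρ / 2) ^ n := by positivity
    -- each term: `‖N‖·Π e^{κ′d}·(ρ/2)ⁿ ≤ A·(ρ/2)ⁿ·Π e^{−(κ₁−κ′)d}`
    have hterm : ∀ c : Fin n → PBond (F.P K) b,
        ‖N K b y n c‖ * (∏ i, Real.exp (κ' * d (c i))) * (ρ / 2) ^ n ≤ A * (ρ / 2) ^ n * ∏ i, Real.exp (-((κ₁ - κ') * d (c i))) := by
      intro c
      have hp : 0 ≤ ∏ i, Real.exp (κ' * d (c i)) := Finset.prod_nonneg fun i _ => (Real.exp_pos _).le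
      calc ‖N K b y n c‖ * (∏ i, Real.exp (κ' * d (c i))) * (ρ / 2) ^ n
          ≤ (A * ∏ i, Real.exp (-(κ₁ * d (c i)))) * (∏ i, Real.exp (κ' * d (c i))) * (ρ / 2) ^ n :=
            mul_le_mul_of_nonneg_right (mul_le_mul_of_nonneg_right (hpt K k b y hY n hn c) hp) hρn
        _ = A * (ρ / 2) ^ n * ((∏ i, Real.exp (-(κ₁ * d (c i)))) * ∏ i, Real.exp (κ' * d (c i))) := by ring
        _ = A * (ρ / 2) ^ n * ∏ i, Real.exp (-((κ₁ - κ') * d (c i))) := by rw [prod_exp_neg_mul_prod_exp]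
    have hsum : ∑ c : Fin n → PBond (F.P K) b, ‖N K b y n c‖ * (∏ i, Real.exp (κ' * d (c i))) * (ρ / 2) ^ n ≤
        A * (ρ / 2) ^ n * (∑ c : PBond (F.P K) b, Real.exp (-((κ₁ - κ') * d c))) ^ n := by
      calc ∑ c : Fin n → PBond (F.P K) b, ‖N K b y n c‖ * (∏ i, Real.exp (κ' * d (c i))) * (ρ / 2) ^ n
          ≤ ∑ c : Fin n → PBond (F.P K) b, A * (ρ / 2) ^ n * ∏ i, Real.exp (-((κ₁ - κ') * d (c i))) := Finset.sum_le_sum fun c _ => hterm c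
        _ = A * (ρ / 2) ^ n * ∑ c : Fin n → PBond (F.P K) b, ∏ i, Real.exp (-((κ₁ - κ') * d (c i))) := by rw [Finset.mul_sum]
        _ = A * (ρ / 2) ^ n * (∑ c : PBond (F.P K) b, Real.exp (-((κ₁ - κ') * d c))) ^ n := by
            rw [Fintype.sum_pow (fun c : PBond (F.P K) b => Real.exp (-((κ₁ - κ') * d c))) n]
    have hpow : (∑ c : PBond (F.P K) b, Real.exp (-((κ₁ - κ') * d c))) ^ n ≤ S ^ n := pow_le_pow_left₀ hleg0 hleg n
    calc ((n ! : ℝ))⁻¹ * ∑ c : Fin n → PBond (F.P K) b, ‖N K b y n c‖ * (∏ i, Real.exp (κ' * d (c i))) * (ρ / 2) ^ n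
        ≤ ((n ! : ℝ))⁻¹ * (A * (ρ / 2) ^ n * S ^ n) :=
          mul_le_mul_of_nonneg_left (hsum.trans (mul_le_mul_of_nonneg_left hpow (by positivity))) hfac
      _ = A * (((n ! : ℝ))⁻¹ * (S * (ρ / 2)) ^ n) := by ring
  -- sum over the orders and trade `1 ≤ e^{κL³}·e^{−κ𝓛}`
  have htot : ∑ n ∈ Finset.Ico 2 7, ((n ! : ℝ))⁻¹ * ∑ c : Fin n → PBond (F.P K) b,
      ‖N K b y n c‖ * (∏ i, Real.exp (κ' * d (c i))) * (ρ / 2) ^ n ≤ A * ∑ n ∈ Finset.Ico 2 7, ((n ! : ℝ))⁻¹ * (S * (ρ / 2)) ^ n := by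
    rw [Finset.mul_sum]
    exact Finset.sum_le_sum hn
  have hsum0 : 0 ≤ ∑ n ∈ Finset.Ico 2 7, ((n ! : ℝ))⁻¹ * (S * (ρ / 2)) ^ n := Finset.sum_nonneg fun n _ => by positivity
  have hE : 1 ≤ Real.exp (κ * (F.L : ℝ) ^ 3) * Real.exp (-κ * (AlphaInputsT3AC.dataOfCoreRows q (canonPolymerRows q)).treeLen K (1 + b) Y) := by
    rw [← Real.exp_add]
    exact Real.one_le_exp (by nlinarith)
  have hSρ : S * (ρ / 2) = legSumConst F.L 𝔠 (κ₁ - κ') * (1 + (F.L : ℝ) ^ 3) * (ρ / 2) := by rw [hS]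
  calc ∑ n ∈ Finset.Ico 2 7, ((n ! : ℝ))⁻¹ * ∑ c : Fin n → PBond (F.P K) b, ‖N K b y n c‖ * (∏ i, Real.exp (κ' * d (c i))) * (ρ / 2) ^ n
      ≤ A * ∑ n ∈ Finset.Ico 2 7, ((n ! : ℝ))⁻¹ * (S * (ρ / 2)) ^ n := htot
    _ = (A * ∑ n ∈ Finset.Ico 2 7, ((n ! : ℝ))⁻¹ * (S * (ρ / 2)) ^ n) * 1 := (mul_one _).symm
    _ ≤ (A * ∑ n ∈ Finset.Ico 2 7, ((n ! : ℝ))⁻¹ * (S * (ρ / 2)) ^ n) *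
          (Real.exp (κ * (F.L : ℝ) ^ 3) * Real.exp (-κ * (AlphaInputsT3AC.dataOfCoreRows q (canonPolymerRows q)).treeLen K (1 + b) Y)) :=
        mul_le_mul_of_nonneg_left hE (mul_nonneg hA hsum0)
    _ = (A * Real.exp (κ * (F.L : ℝ) ^ 3) *
          ∑ n ∈ Finset.Ico 2 7, ((n ! : ℝ))⁻¹ * (legSumConst F.L 𝔠 (κ₁ - κ') * (1 + (F.L : ℝ) ^ 3) * (ρ / 2)) ^ n) *
        Real.exp (-κ * (AlphaInputsT3AC.dataOfCoreRows q (canonPolymerRows q)).treeLen K (1 + b) Y) := by rw [hSρ]; ring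

/-- **THE BUDGET IN THE LETTERS OF THE NATURAL-OBJECT DOORS** (`hker` of ✓`chartAnalyticOwnΦ_rescaleW_naturalChart_rows(_of_local)`, any radius `ρ ≥ 0`): the pointwise (43)
decay with rate `κ₁ > κ′` gives `hker` with `C_A := A·e^{κL³}·Σ_{n∈[2,7)} (n!)⁻¹ (legSumConst(κ₁−κ′)(1+L³)ρ/2)ⁿ`. [cite: Balaban1985UV3, (43) p.266, (45) p.267] -/
theorem kernelBudget_of_pointwise {κ' κ₁ κ A ρ : ℝ} (hκ' : κ' < κ₁) (hκ : 0 ≤ κ) (hA : 0 ≤ A) (hρ : 0 ≤ ρ)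
    (hpt : ∀ (K k b : ℕ) (y : Site (F.P K) (1 + b)), blockSet K (1 + b) y ∈ canonLocRows q K k (Hist.triv (F.P K) k) (1 + b) →
      ∀ n ∈ Finset.Ico 2 7, ∀ c : Fin n → PBond (F.P K) b,
        ‖N K b y n c‖ ≤ A * ∏ i, Real.exp (-(κ₁ * canonLegDist F K b (blockSet K (1 + b) y) (c i)))) :
    ∀ (K k b : ℕ) (y : Site (F.P K) (1 + b)), blockSet K (1 + b) y ∈ canonLocRows q K k (Hist.triv (F.P K) k) (1 + b) →
      ∑ n ∈ Finset.Ico 2 7, ((n ! : ℝ))⁻¹ * ∑ c : Fin n → PBond (F.P K) b,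
        ‖N K b y n c‖ * (∏ i, Real.exp (κ' * canonLegDist F K b (blockSet K (1 + b) y) (c i))) * (ρ / 2) ^ n ≤
          (A * Real.exp (κ * (F.L : ℝ) ^ 3) *
              ∑ n ∈ Finset.Ico 2 7, ((n ! : ℝ))⁻¹ * (legSumConst F.L 𝔠 (κ₁ - κ') * (1 + (F.L : ℝ) ^ 3) * (ρ / 2)) ^ n) *
            Real.exp (-κ * (AlphaInputsT3AC.dataOfCoreRows q (canonPolymerRows q)).treeLen K (1 + b) (blockSet K (1 + b) y)) :=
  fun K k b y hY => kernelBudget_blockSet_of_pointwise q N hκ' hκ hA hρ hpt K k b y hY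

/-- The budget constant is nonnegative. [folklore] -/
theorem kernelBudgetConst_nonneg {κ' κ₁ κ A ρ : ℝ} (hA : 0 ≤ A) (hρ : 0 ≤ ρ) :
    0 ≤ A * Real.exp (κ * (F.L : ℝ) ^ 3) *
      ∑ n ∈ Finset.Ico 2 7, ((n ! : ℝ))⁻¹ * (legSumConst F.L 𝔠 (κ₁ - κ') * (1 + (F.L : ℝ) ^ 3) * (ρ / 2)) ^ n := by
  have := legSumConst_nonneg F.L 𝔠 (κ₁ - κ')
  have : 0 ≤ ∑ n ∈ Finset.Ico 2 7, ((n ! : ℝ))⁻¹ * (legSumConst F.L 𝔠 (κ₁ - κ') * (1 + (F.L : ℝ) ^ 3) * (ρ / 2)) ^ n :=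
    Finset.sum_nonneg fun n _ => by positivity
  positivity

end Budget

end Summit.QuantumFields.YangMills.Theorems.GlobalSlackKernelLeg

end
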